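import Summits.QuantumFields.YangMills.Theorems.UnitScaleTiltProp7OffsetFamilyTransported
import HarnessLib

/-!
# Route `UnitScaleTilt`, crux K1 «MinimiserStabilityRegPr» (stmt-QuantumFields-19200), route-R E′ path (α′), S3 K-form engine, (H)-RED-1′ «hDir ⟸ hKg′-K(fam)» — FILE 9s (T³ letters):
# THE DIRICHLET ROW OF THE OFFSET-COMB LOCAL MODELS IS THE (Kg′) FAMILY — unconditional, no booking: for the h-averaged offset-comb axial models
# `Ψ̄_y(z) = ℓ′⁻¹Σ_(h<ℓ′) R(axialT 𝒲 c^h_y z)⁻¹ m^h_y` (★p1 g16's ROW (H) KNIT ✓p679008 instantiated at THESE `Ψ`), the supported covariant Dirichlet energy (`hDir`'s left side)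
# `Σ_y Σ_(z∈N(y)) Σ_μ (‖D*_𝒲Ψ̄_y(z,μ)‖² + ‖D_𝒲Ψ̄_y(z,μ)‖²)` is AT MOST the averaged-path (Kg′) family of ✓p676852 (`hKg′-K(R4′-fam)`'s left side, sup weights; `R = 2ℓ+ℓ′`), with NO
# second-order ∕ `a²` term — convexity, the exact ladder∕commutator identity, Cauchy–Schwarz and px9's count, every transport bi-contractive (★p1 g16 NAMER WORD 11 (1) «routeR-w1:
# (H)-RED-1′ GO»).  Hence `hDir ⟸ hKg′-K(fam)` with `ζ_D = C_g′`, `θ_D = θ_g′` is ONE `le_trans` for the knitter.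

Cell `ym3-torus`, D-0154 (3c) twin-width seat `ym-routeR-w1` (gen 6); standing PASS R4′ (★p1 g16).  THEOREMS ONLY (0 `def`, 0 `sorry`); `--supports stmt-QuantumFields-19200`, count-neutral.
YM₃ on T³ is a ladder rung (R3), not the Clay problem; nothing here claims a stub, the crux, d = 4 or the gap.

WHAT (ns `…Theorems.Prop7DirichletOfOffsetFamily`): §1 ★★ `dirichlet_avg_axial_le_canonical` (any torus, any averaged axial family, geometry rows displayed); §2 ★★★ `dirichlet_offsetFamily_le_transported`
(T³, the offset-comb family, window rows discharged by ✓ `abs_rel_offset_le`, letters transported by ✓ `canonical_letter_eq_transported`).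
HONEST SCOPE.  Re-assembly of landed bricks (✓p670146, ✓p671704, ✓p675053, ✓p675776, ✓p676499, ✓p676852); no estimate of the series; the exact-weight twin is px9 g4's one-line swap
(✓p679028 in place of ✓ `sum_ite_comm_loopT_sq_le_canonical`).

References: T. Bałaban, CMP 99 (1985) 389–434 [Balaban1985BackgroundPropagators] ((3.3) p.390, (3.8) p.392); CMP 98 (1985) 17–51 [Balaban1985Averaging] ((9) p.18, (19)–(20) p.21,
p.24); CMP 102 (1985) 255–275 [Balaban1985UV3] ((27) p.263).
-/

set_option autoImplicit false

noncomputable section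

open scoped BigOperators Matrix.Norms.L2Operator Matrix

namespace Summit.QuantumFields.YangMills.Theorems.Prop7DirichletOfOffsetFamily

open Literature.MathematicalPhysics.QuantumFieldTheory.Balaban1983to89
open Literature.MathematicalPhysics.QuantumFieldTheory.Balaban1983to89.T3ContinuumYM3Torus
open B7Prop1Explicit (Letter e seg treeWord hol)
open B10Eq27AxialLog (contour27)
open B9Eq39Adjoint (R covD covDstar divB)
open B9TorusCalculus (torusT)
open B10Eq27TorusAxialLog (unitsField toUField holT axialT contourT rel pull transl)
open B5Eq118OneStroke (iterBlockOf)
open B15DeterminingSets (embIter)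
open Summit.QuantumFields.YangMills.Theorems.Prop7CovHodgeSplit (unitsField_toUField_mem_unitary)
open Summit.QuantumFields.YangMills.Theorems.Prop7LemmaHCurvedOfRows (bicontr_of_mem_unitary)
open Summit.QuantumFields.YangMills.Theorems.Prop7AxialLocalModel (norm_covD_axialModel_le norm_covDstar_axialModel_le)
open Summit.QuantumFields.YangMills.Theorems.Prop7LocalModelAverage (norm_sq_covD_avg_le norm_sq_covDstar_avg_le)
open Summit.QuantumFields.YangMills.Theorems.Prop7LemmaHCurvedDirichletCount (sum_ite_sum_mul_sum_comm sum_ite_comm_loopT_sq_le_canonical)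
open Summit.QuantumFields.YangMills.Theorems.Prop7OffsetFamilyWindow (abs_rel_offset_le)
open Summit.QuantumFields.YangMills.Theorems.Prop7OffsetFamilyTransported (canonical_letter_eq_transported)

/-! ## §1 Any averaged axial family on a torus: the Dirichlet energy on the support in canonical (Kg′) letters -/

section Torus

variable {𝔸 : Type*} [NormedRing 𝔸] [NormedAlgebra ℝ 𝔸] [NormOneClass 𝔸] {P : Params} {j : ℕ} (V : GaugeField P j 𝔸ˣ)
  (hV : ∀ b : PBond P j, ‖(V b : 𝔸)‖ ≤ 1 ∧ ‖(((V b)⁻¹ : 𝔸ˣ) : 𝔸)‖ ≤ 1)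

include hV in
/-- ★★ **THE SUPPORTED DIRICHLET ENERGY OF AN AVERAGED AXIAL FAMILY IN CANONICAL LETTERS** (per block): for bases `C^η`, data `M^η` and the averaged model
`Ψ̄(z) = |H|⁻¹Σ_η R(axialT V C^η z)⁻¹ M^η`: `Σ_z [N z] Σ_μ (‖D*_V Ψ̄(z,μ)‖² + ‖D_V Ψ̄(z,μ)‖²) ≤ |H|⁻¹Σ_η 2·Σ_μ (|t_μ|R)·Σ_(i<|t_μ|) (2R+1)^(|t_μ|−i)·Σ_(q∈[−R,R]^d) (f_η(q,(t_(μ,i),+)) + f_η(q,(t_(μ,i),−)))`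
(convexity ✓ `norm_sq_covD[star]_avg_le` ∘ axial rows ✓ `norm_covD[star]_axialModel_le` ∘ ✓ `sum_ite_sum_mul_sum_comm` ∘ ✓ `sum_ite_comm_loopT_sq_le_canonical`); geometry rows (window,
no-wrap) displayed as `hgeo`. [cite: Balaban1985BackgroundPropagators, (3.3) p.390, (3.8) p.392] [cite: Balaban1985UV3, (27) p.263] [cite: Balaban1985Averaging, (9) p.18, (19)–(20) p.21] -/
theorem dirichlet_avg_axial_le_canonical {H : Type*} [Fintype H] [Nonempty H] (C : H → Site P j) (M : H → 𝔸) (N : Site P j → Prop) [DecidablePred N] (R₀ : ℕ)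
    (hgeo : ∀ z, N z → ∀ (η : H) (μ ν : Fin P.d), |rel (C η) z ν| ≤ (R₀ : ℤ) ∧ |rel (C η) ((torusT P j μ).symm z) ν| ≤ (R₀ : ℤ)
      ∧ (rel (C η) z ν + 1) * 2 ≤ (P.sitesPerDir j : ℤ) ∧ (rel (C η) ((torusT P j μ).symm z) ν + 1) * 2 ≤ (P.sitesPerDir j : ℤ))
    (s t : Fin P.d → List (Fin P.d)) (hsplit : ∀ μ, (List.finRange P.d).reverse = s μ ++ μ :: t μ) (hs : ∀ μ, μ ∉ s μ) (ht : ∀ μ, μ ∉ t μ) :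
    ∑ z : Site P j, (if N z then ∑ μ : Fin P.d,
        (‖covDstar (torusT P j) (fun κ z => V ⟨z, κ⟩) μ (fun z => (Fintype.card H : ℝ)⁻¹ • ∑ η, R (axialT V (C η) z)⁻¹ (M η)) z‖ ^ 2
          + ‖covD (torusT P j) (fun κ z => V ⟨z, κ⟩) μ (fun z => (Fintype.card H : ℝ)⁻¹ • ∑ η, R (axialT V (C η) z)⁻¹ (M η)) z‖ ^ 2) else 0)
      ≤ (Fintype.card H : ℝ)⁻¹ * ∑ η, (2 * ∑ μ : Fin P.d, ((((t μ).length * R₀ : ℕ) : ℝ) * ∑ i ∈ Finset.range (t μ).length, (((2 * R₀ + 1) ^ ((t μ).length - i) : ℕ) : ℝ)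
          * ∑ q ∈ Fintype.piFinset (fun _ : Fin P.d => Finset.Icc (-(R₀ : ℤ)) (R₀ : ℤ)),
              (‖((hol (pull V (C η)) q [((t μ).getD i μ, true), (μ, true), Letter.rev ((t μ).getD i μ, true), (μ, false)] : 𝔸ˣ) : 𝔸)
                    * R (hol (pull V (C η)) 0 (treeWord q))⁻¹ (M η)
                  - R (hol (pull V (C η)) 0 (treeWord q))⁻¹ (M η)
                    * ((hol (pull V (C η)) q [((t μ).getD i μ, true), (μ, true), Letter.rev ((t μ).getD i μ, true), (μ, false)] : 𝔸ˣ) : 𝔸)‖ ^ 2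
              + ‖((hol (pull V (C η)) q [((t μ).getD i μ, false), (μ, true), Letter.rev ((t μ).getD i μ, false), (μ, false)] : 𝔸ˣ) : 𝔸)
                    * R (hol (pull V (C η)) 0 (treeWord q))⁻¹ (M η)
                  - R (hol (pull V (C η)) 0 (treeWord q))⁻¹ (M η)
                    * ((hol (pull V (C η)) q [((t μ).getD i μ, false), (μ, true), Letter.rev ((t μ).getD i μ, false), (μ, false)] : 𝔸ˣ) : 𝔸)‖ ^ 2))) := by
  have hc0 : (0 : ℝ) ≤ (Fintype.card H : ℝ)⁻¹ := by positivity
  have step1 : ∀ z, N z → ∀ μ : Fin P.d,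
      ‖covDstar (torusT P j) (fun κ z => V ⟨z, κ⟩) μ (fun z => (Fintype.card H : ℝ)⁻¹ • ∑ η, R (axialT V (C η) z)⁻¹ (M η)) z‖ ^ 2
        + ‖covD (torusT P j) (fun κ z => V ⟨z, κ⟩) μ (fun z => (Fintype.card H : ℝ)⁻¹ • ∑ η, R (axialT V (C η) z)⁻¹ (M η)) z‖ ^ 2
      ≤ (Fintype.card H : ℝ)⁻¹ * ∑ η,
          (‖((holT V (C η) (contourT (C η) ⟨(torusT P j μ).symm z, μ⟩) : 𝔸ˣ) : 𝔸) * M η - M η * ((holT V (C η) (contourT (C η) ⟨(torusT P j μ).symm z, μ⟩) : 𝔸ˣ) : 𝔸)‖ ^ 2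
            + ‖((holT V (C η) (contourT (C η) ⟨z, μ⟩) : 𝔸ˣ) : 𝔸) * M η - M η * ((holT V (C η) (contourT (C η) ⟨z, μ⟩) : 𝔸ˣ) : 𝔸)‖ ^ 2) := by
    intro z hz μ
    have cv1 := norm_sq_covDstar_avg_le (torusT P j) (fun κ z => V ⟨z, κ⟩) (fun η z => R (axialT V (C η) z)⁻¹ (M η)) μ z
    have cv2 := norm_sq_covD_avg_le (torusT P j) (fun κ z => V ⟨z, κ⟩) (fun η z => R (axialT V (C η) z)⁻¹ (M η)) μ z
    refine (add_le_add cv1 cv2).trans ?_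
    rw [← mul_add, ← Finset.sum_add_distrib]
    refine mul_le_mul_of_nonneg_left (Finset.sum_le_sum fun η _ => add_le_add ?_ ?_) hc0
    · exact pow_le_pow_left₀ (norm_nonneg _) (norm_covDstar_axialModel_le V hV (C η) (M η) μ z (hgeo z hz η μ μ).2.2.2) 2
    · exact pow_le_pow_left₀ (norm_nonneg _) (norm_covD_axialModel_le V hV (C η) (M η) μ z (hgeo z hz η μ μ).2.2.1) 2
  have step2 : ∑ z : Site P j, (if N z then ∑ μ : Fin P.d,
        (‖covDstar (torusT P j) (fun κ z => V ⟨z, κ⟩) μ (fun z => (Fintype.card H : ℝ)⁻¹ • ∑ η, R (axialT V (C η) z)⁻¹ (M η)) z‖ ^ 2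
          + ‖covD (torusT P j) (fun κ z => V ⟨z, κ⟩) μ (fun z => (Fintype.card H : ℝ)⁻¹ • ∑ η, R (axialT V (C η) z)⁻¹ (M η)) z‖ ^ 2) else 0)
      ≤ ∑ z : Site P j, (if N z then ∑ μ : Fin P.d, (Fintype.card H : ℝ)⁻¹ * ∑ η,
          (‖((holT V (C η) (contourT (C η) ⟨(torusT P j μ).symm z, μ⟩) : 𝔸ˣ) : 𝔸) * M η - M η * ((holT V (C η) (contourT (C η) ⟨(torusT P j μ).symm z, μ⟩) : 𝔸ˣ) : 𝔸)‖ ^ 2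
            + ‖((holT V (C η) (contourT (C η) ⟨z, μ⟩) : 𝔸ˣ) : 𝔸) * M η - M η * ((holT V (C η) (contourT (C η) ⟨z, μ⟩) : 𝔸ˣ) : 𝔸)‖ ^ 2) else 0) :=
    Finset.sum_le_sum fun z _ => by
      split_ifs with hz
      · exact Finset.sum_le_sum fun μ _ => step1 z hz μ
      · exact le_rfl
  rw [sum_ite_sum_mul_sum_comm] at step2
  refine step2.trans (mul_le_mul_of_nonneg_left (Finset.sum_le_sum fun η _ => ?_) hc0)
  exact sum_ite_comm_loopT_sq_le_canonical V hV (C η) (M η) N R₀ (fun z hz μ ν => ⟨(hgeo z hz η μ ν).1, (hgeo z hz η μ ν).2.1⟩) s t hsplit hs ht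

end Torus

/-! ## §2 The offset-comb family on T³: hDir's left side ≤ the (Kg′) family, transported-plaquette letters -/

section T3

/-- ★★★ **hDir ⟸ hKg′-K(fam), UNCONDITIONAL PART** ((H)-RED-1′): for the h-averaged offset-comb local models of ✓p675776∕✓p676852 the supported covariant Dirichlet energy is at most
the averaged-path (Kg′) family (sup weights, `R = 2ℓ + ℓ′`, window `2(2ℓ+ℓ′) < N`), letters transported to the centres: `P̃ = R(𝒲(c_y;[ι]^h ++ Γ_(0,q)))·𝒲_(c^h_y+q)(rung word)`.
[cite: Balaban1985BackgroundPropagators, (3.3) p.390, (3.8) p.392] [cite: Balaban1985Averaging, (9) p.18, (19)–(20) p.21, p.24] [cite: Balaban1985UV3, (27) p.263] -/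
theorem dirichlet_offsetFamily_le_transported (F : T3Family) (K n : ℕ) (hk : K - n ≤ (F.P K).m + (F.P K).K)
    (W : GaugeField (F.P K) 0 (Matrix.specialUnitaryGroup (Fin 2) ℂ)) (ψ : Site (F.P K) 0 → Matrix (Fin 2) (Fin 2) ℂ)
    (ι : Fin (F.P K).d) (ℓ' : ℕ) [NeZero ℓ'] (hN : (2 * (F.P K).L ^ (K - n) + ℓ') * 2 < (F.P K).sitesPerDir 0)
    (s t : Fin (F.P K).d → List (Fin (F.P K).d)) (hsplit : ∀ μ, (List.finRange (F.P K).d).reverse = s μ ++ μ :: t μ) (hs : ∀ μ, μ ∉ s μ) (ht : ∀ μ, μ ∉ t μ) :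
    ∑ y : Site (F.P K) (K - n), ∑ z : Site (F.P K) 0,
      (if (∀ ν : Fin (F.P K).d,
          (y ν = (iterBlockOf (K - n) (fun κ => z κ - (((((F.P K).L ^ (K - n) - 1) / 2 : ℕ)) : ZMod ((F.P K).sitesPerDir 0)))) ν - 1
          ∨ y ν = (iterBlockOf (K - n) (fun κ => z κ - (((((F.P K).L ^ (K - n) - 1) / 2 : ℕ)) : ZMod ((F.P K).sitesPerDir 0)))) ν
          ∨ y ν = (iterBlockOf (K - n) (fun κ => z κ - (((((F.P K).L ^ (K - n) - 1) / 2 : ℕ)) : ZMod ((F.P K).sitesPerDir 0)))) ν + 1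
          ∨ y ν = (iterBlockOf (K - n) (fun κ => z κ - (((((F.P K).L ^ (K - n) - 1) / 2 : ℕ)) : ZMod ((F.P K).sitesPerDir 0)))) ν + 2))
        then ∑ μ : Fin (F.P K).d,
          (‖covDstar (torusT (F.P K) 0) (fun κ z => unitsField (toUField W) ⟨z, κ⟩) μ
              (fun z => (ℓ' : ℝ)⁻¹ • ∑ η : Fin ℓ', R (axialT (unitsField (toUField W)) (transl (embIter (K - n) y) (((η : ℕ) : ℤ) • e ι)) z)⁻¹ (R (holT (unitsField (toUField W)) (embIter (K - n) y) (seg ι ((η : ℕ) : ℤ)))⁻¹ (ψ (embIter (K - n) y)))) z‖ ^ 2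
            + ‖covD (torusT (F.P K) 0) (fun κ z => unitsField (toUField W) ⟨z, κ⟩) μ
              (fun z => (ℓ' : ℝ)⁻¹ • ∑ η : Fin ℓ', R (axialT (unitsField (toUField W)) (transl (embIter (K - n) y) (((η : ℕ) : ℤ) • e ι)) z)⁻¹ (R (holT (unitsField (toUField W)) (embIter (K - n) y) (seg ι ((η : ℕ) : ℤ)))⁻¹ (ψ (embIter (K - n) y)))) z‖ ^ 2) else 0)
      ≤ ∑ y : Site (F.P K) (K - n), (ℓ' : ℝ)⁻¹ * ∑ η : Fin ℓ', (2 * ∑ μ : Fin (F.P K).d,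
              ((((t μ).length * (2 * (F.P K).L ^ (K - n) + ℓ') : ℕ) : ℝ) * ∑ i ∈ Finset.range (t μ).length, (((2 * (2 * (F.P K).L ^ (K - n) + ℓ') + 1) ^ ((t μ).length - i) : ℕ) : ℝ)
                * ∑ q ∈ Fintype.piFinset (fun _ : Fin (F.P K).d => Finset.Icc (-((2 * (F.P K).L ^ (K - n) + ℓ') : ℤ)) ((2 * (F.P K).L ^ (K - n) + ℓ') : ℤ)),
                    (‖R (holT (unitsField (toUField W)) (embIter (K - n) y) (seg ι ((η : ℕ) : ℤ) ++ treeWord q))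
                          ((holT (unitsField (toUField W)) (transl (transl (embIter (K - n) y) (((η : ℕ) : ℤ) • e ι)) q) [((t μ).getD i μ, true), (μ, true), Letter.rev ((t μ).getD i μ, true), (μ, false)] : (Matrix (Fin 2) (Fin 2) ℂ)ˣ) : Matrix (Fin 2) (Fin 2) ℂ)
                        * ψ (embIter (K - n) y)
                      - ψ (embIter (K - n) y)
                        * R (holT (unitsField (toUField W)) (embIter (K - n) y) (seg ι ((η : ℕ) : ℤ) ++ treeWord q))
                          ((holT (unitsField (toUField W)) (transl (transl (embIter (K - n) y) (((η : ℕ) : ℤ) • e ι)) q) [((t μ).getD i μ, true), (μ, true), Letter.rev ((t μ).getD i μ, true), (μ, false)] : (Matrix (Fin 2) (Fin 2) ℂ)ˣ) : Matrix (Fin 2) (Fin 2) ℂ)‖ ^ 2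
                    + ‖R (holT (unitsField (toUField W)) (embIter (K - n) y) (seg ι ((η : ℕ) : ℤ) ++ treeWord q))
                          ((holT (unitsField (toUField W)) (transl (transl (embIter (K - n) y) (((η : ℕ) : ℤ) • e ι)) q) [((t μ).getD i μ, false), (μ, true), Letter.rev ((t μ).getD i μ, false), (μ, false)] : (Matrix (Fin 2) (Fin 2) ℂ)ˣ) : Matrix (Fin 2) (Fin 2) ℂ)
                        * ψ (embIter (K - n) y)
                      - ψ (embIter (K - n) y)
                        * R (holT (unitsField (toUField W)) (embIter (K - n) y) (seg ι ((η : ℕ) : ℤ) ++ treeWord q))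
                          ((holT (unitsField (toUField W)) (transl (transl (embIter (K - n) y) (((η : ℕ) : ℤ) • e ι)) q) [((t μ).getD i μ, false), (μ, true), Letter.rev ((t μ).getD i μ, false), (μ, false)] : (Matrix (Fin 2) (Fin 2) ℂ)ˣ) : Matrix (Fin 2) (Fin 2) ℂ)‖ ^ 2))) := by
  classical
  have hV : ∀ b : PBond (F.P K) 0, ‖((unitsField (toUField W) b : (Matrix (Fin 2) (Fin 2) ℂ)ˣ) : Matrix (Fin 2) (Fin 2) ℂ)‖ ≤ 1
      ∧ ‖(((unitsField (toUField W) b)⁻¹ : (Matrix (Fin 2) (Fin 2) ℂ)ˣ) : Matrix (Fin 2) (Fin 2) ℂ)‖ ≤ 1 :=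
    fun b => bicontr_of_mem_unitary _ (unitsField_toUField_mem_unitary W b.dir b.src)
  have hcard : ((Fintype.card (Fin ℓ') : ℝ))⁻¹ = (ℓ' : ℝ)⁻¹ := by rw [Fintype.card_fin]
  refine Finset.sum_le_sum fun y _ => ?_
  have h1 := dirichlet_avg_axial_le_canonical (unitsField (toUField W)) hV
    (fun η : Fin ℓ' => transl (embIter (K - n) y) (((η : ℕ) : ℤ) • e ι))
    (fun η : Fin ℓ' => R (holT (unitsField (toUField W)) (embIter (K - n) y) (seg ι ((η : ℕ) : ℤ)))⁻¹ (ψ (embIter (K - n) y)))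
    (fun z => (∀ ν : Fin (F.P K).d, (y ν = (iterBlockOf (K - n) (fun κ => z κ - (((((F.P K).L ^ (K - n) - 1) / 2 : ℕ)) : ZMod ((F.P K).sitesPerDir 0)))) ν - 1 ∨ y ν = (iterBlockOf (K - n) (fun κ => z κ - (((((F.P K).L ^ (K - n) - 1) / 2 : ℕ)) : ZMod ((F.P K).sitesPerDir 0)))) ν ∨ y ν = (iterBlockOf (K - n) (fun κ => z κ - (((((F.P K).L ^ (K - n) - 1) / 2 : ℕ)) : ZMod ((F.P K).sitesPerDir 0)))) ν + 1 ∨ y ν = (iterBlockOf (K - n) (fun κ => z κ - (((((F.P K).L ^ (K - n) - 1) / 2 : ℕ)) : ZMod ((F.P K).sitesPerDir 0)))) ν + 2)))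
    (2 * (F.P K).L ^ (K - n) + ℓ') (fun z hz η μ ν => abs_rel_offset_le hk ℓ' hN y z hz η ι μ ν) s t hsplit hs ht
  rw [hcard] at h1
  simp only [canonical_letter_eq_transported _ hV] at h1
  exact h1

end T3

end Summit.QuantumFields.YangMills.Theorems.Prop7DirichletOfOffsetFamily

end
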